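import Summits.QuantumFields.BalabanUV.Beta.FP.TowerHLinkRows

/-!
# `BalabanUV.Beta.FP.TowerWeightWords` — road «FP», binder row D1, ROUTE T (β1): **THE STOREY WEIGHT WORDS AT THE ROAD's DATA** — an2 PART 19 §3's `hword`
# (`σ·Σ'_m (w·Σ_ā hb ā·cf κ (translate Tc′ ρ m) ā.2 ā.1) = Pn.cΛ (j+1)·Σ'_m λ′ᴿ(κ, translate Tc′ ρ m)`) for EVERY storey of the END wrapper, along the pinned direction
# `dv = r•e_a` (R-FP-79), REDUCED TO THE ONE SCALAR ROW `w (n+1)·r = Pn.cΛ (n+2)`; and the lock algebra R-FP-81: with K1's `w (n+1) = −c·(Lc⁴)^{n+2}` and (E4d)'s pin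
# `(−2c)·r = Pn.cE (n+2)` that row reads `2·Pn.cΛ (n+2) = (Lc⁴)^{n+2}·Pn.cE (n+2)` — the DEFINITION of the depth-(n+2) lock (an2 g64 A-1 l.67520: a junction condition on `Pn`)

WHY (`HOME/b2b-balaban-beta-d1-p3/g41/SPEC-52.md` §C; an2 g64 A-1 l.67520; road g41 l.67511∕l.67532).  The (J-Λ) junction `hΛN` of road `TorusLamJunctionShape.lamJunction_of_dper_eq`
is assembled storey by storey from an2 PARTs 15–19; PART 19 `dper_slamCore_eq_dper_lamCoreR_of_word` turns the road's displayed storey core into the row's `𝒢ᴿ` GIVEN the storey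
weight word.  With the road's data of `FP/TowerHLinkRows` (`cf (n+1) := cfTop`, `cf k := δ`, `hb (n+1) := hv`, `hb k :=` the root-bond embedding of `λ̂′ᴿ_k`, `w ∕ κ` the ladder
scalars) the word's left contraction IS `r·λ̂′ᴿ_k^{(a)}` at every storey (an2 PART 25's fold at the top, `TowerHLinkRowsLower`'s δ-contraction below), and the road's leg scalar
`σ_k = (Π_{i ∈ Ico k (n+1)} stepScale 3 Lc (n−i)·Lc⁴)²` (an2 PART 17 `compLinKer_road_eq_scaled`, two legs) satisfies `σ_k·w k = w (n+1)` by the road's own ladder (`#B = Lc⁴`) —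
so EVERY storey word is the top scalar row `w (n+1)·r = Pn.cΛ (n+2)` (an2 g64's reading, typed).

WHAT ([folklore] finite-sum ∕ `tsum` bookkeeping BY NAME; no `def`, no `def … : Prop`, nothing cited, 0 sorry; binders `cfF hcfF hbF hhbF κF hκF wF hwF` with DEFINING
EQUATIONS as in `TowerHLinkRows`; `cΛ'` a free real — the instantiation's `Pn.cΛ (n+2)`):
§1 `card_box_four` (`#B = Lc⁴`), **`legScalar_sq_mul_w`** (`(Π_{i ∈ Ico k (n+1)} stepScale 3 Lc (n+1−(i+1))·Lc⁴)²·w k = w (n+1)`); §2 **`lam_contraction`** (at every level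
`k ≤ n+1`: `Σ_ā hb k v ā·(Σ'_m cf k κ₁ (translate (towerTorus Lc M k) s m) ā.2 ā.1) = Σ_{a′} v a′·λ̂′ᴿ_k^{(a′)}(κ₁, s)` — top: `hJW ∕ hfold ∕ (β)`, below: the δ-contraction),
§3 **`weight_word`** (PART 19's `hword` at the road's data, every storey, from `htop : w (n+1)·r = cΛ'`);
§4 **`lock_relation`** (R-FP-81: `w₁ = −c·L8 ∧ (−2c)·r = cE ∧ w₁·r = cΛ → 2·cΛ = L8·cE`, pure `ring`).
WHAT THIS IS NOT: not `hΛN` (the sandwich assembly — road g42 with PARTs 15–17∕19 + `lamJunction_of_dper_eq`), not the value of `Pn.cΛ (n+2)` (a row of the (C1) instantiation),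
not (E4e); no row of the END wrapper discharged; 0 estimates; nothing of Bałaban's asserted, valued or discharged; 0∕4 row-D1 binders (hW, hR, D1Tel, D1Rep); ROOT M‴ p325680 ∕
P5c ∕ D6 untouched; NOT (C1), NOT (L2′), NOT (T-ID), NOT SDF, NOT D1, NEVER «G-an2-4 closed», NOT BetaPertH, NOT continuum, NOT Clay.

HONEST DEPENDENCY (page 1, mandatory): continuum YM on T⁴ ⇐ BetaPertH ∧ nine spine estimates (0/9 proved); BetaPertH ⇐ (D1) ∧ (D4) ∧ CAP+tail;
G-an2-4 gates asym, D1 and NE2/3/4.  HONEST FRAMING (cell contract, verbatim): «discharging `BetaPertH` makes Bałaban's UV stability UNCONDITIONAL —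
a real constructive-QFT result; it is NOT the continuum limit and NOT the Clay problem.»  ABSOLUTE RULE (cell charter, verbatim): «No internally-minted
statement may enter as a cited fact. Every hypothesis is either kernel-proved in this package or a verbatim quotation of a PUBLISHED theorem with page
reference. The manuscript(s) under audit are NOT citable for their own disputed steps — they are the thing under adjudication; programme-internal
(2001/route/tribunal) claims are never citable.»  Road «FP» OWNER, b2b-balaban-beta-d1-p3 gen 41, 2026-08-27.  No existing file touched.
-/

noncomputable section

open scoped BigOperators

namespace Summit.QuantumFields.BalabanUV.Beta.FP.TowerWeightWords

open Finset
open Literature.MathematicalPhysics.QuantumFieldTheory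
open Literature.MathematicalPhysics.QuantumFieldTheory.Balaban1983to89
open Literature.MathematicalPhysics.QuantumFieldTheory.Balaban1983to89.Beta
open B4TorusKernel.MultiPeriod (translate)
open B5Prop11Plancherel (fine)
open B6Lemma24Torus (pbox wrap)
open AffineAveraging (Site box toSite)
open AveragingHessianKernels (Bond)
open OneStepResolventKernel (Fib KInv)
open BalabanStepJets (lamCoeffOf)
open Summit.QuantumFields.BalabanUV.Beta.CompositeOneShotJetData (Roots AN)
open Summit.QuantumFields.BalabanUV.Beta.CompositeVertexKernelRec (compLinKer)
open Summit.QuantumFields.BalabanUV.Beta.SymAveragingHessianCounts (symLinKerAt)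
open Summit.QuantumFields.BalabanUV.Beta.BorderedHessian (stepScale stepScale_ne_zero)
open Summit.QuantumFields.BalabanUV.Beta.FP.KernelPeriodisationFib (perF)
open Summit.QuantumFields.BalabanUV.Beta.FP.TorusCompositeObjects (towerTorus)
open Summit.QuantumFields.BalabanUV.Beta.FP.TorusGaugeCovariance (tgrad)
open Summit.QuantumFields.BalabanUV.Beta.FP.TorusGaugeCovariancePairing (wrapPt wrapPt_of_mem)
open Summit.QuantumFields.BalabanUV.Beta.NVertexLamCorePeriodised (towerTorus_fine_apply_eq)
open Summit.QuantumFields.BalabanUV.Beta.FP.TowerK1RowTopCoefficients (sum_exact_mul_tsum_cfTop_eq_zero apply_eq_sum_mul_single_of_linear)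
open Summit.QuantumFields.BalabanUV.Beta.FP.TowerHLinkRowsLower (sum_hbDelta_mul_tsum_cfDelta kappa_ne_zero w_top)
open Summit.QuantumFields.BalabanUV.Beta.FP.TowerHLinkRows (cf_summable lamLow_wrap)

variable {Lc : ℕ} [NeZero Lc] (R : Roots Lc) (n : ℕ) (M : Fin (3 + 1) → ℕ) [∀ i, NeZero (M i)]

/-! ## §1 The leg scalars against the ladder -/

section Scalars

variable (c : ℝ)

omit [NeZero Lc] in
/-- [folklore] `#B = Lc⁴`. -/
theorem card_box_four : ((box (3 + 1) Lc).card : ℝ) = (Lc : ℝ) ^ (3 + 1) := by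
  have h : (box (3 + 1) Lc).card = Lc ^ (3 + 1) := by simp [AffineAveraging.box, Fintype.card_piFinset]
  rw [h]; push_cast; rfl

/-- [folklore] **`legScalar_sq_mul_w` — THE ROAD's TWO-LEG SCALAR OF STOREY `k` TIMES ITS WEIGHT IS THE TOP WEIGHT**:
`(Π_{i ∈ Ico k (n+1)} stepScale 3 Lc (n+1−(i+1))·Lc⁴)²·w k = w (n+1)` (`κ k = Π stepScale·#B = Π stepScale·Lc⁴`; `TowerHLinkRowsLower.w_top`). -/
theorem legScalar_sq_mul_w (κF wF : ℕ → ℝ)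
    (hκF : ∀ k, κF k = ∏ i ∈ Finset.Ico k (n + 1), (stepScale 3 Lc (n + 1 - (i + 1)) * ((box (3 + 1) Lc).card : ℝ)))
    (hwF : ∀ k, wF k = (-(c * ((Lc : ℝ) ^ (3 + 1)) ^ (n + 1 + 1))
        / ∏ i ∈ Finset.Ico k (n + 1), (stepScale 3 Lc (n + 1 - (i + 1)) * (Lc : ℝ) ^ (3 + 1))) / κF k) (k : ℕ) :
    (∏ i ∈ Finset.Ico k (n + 1), (stepScale 3 Lc (n + 1 - (i + 1)) * (Lc : ℝ) ^ (3 + 1))) ^ 2 * wF k = wF (n + 1) := by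
  have hLc : (Lc : ℝ) ≠ 0 := Nat.cast_ne_zero.mpr (NeZero.ne Lc)
  have hP : ∏ i ∈ Finset.Ico k (n + 1), (stepScale 3 Lc (n + 1 - (i + 1)) * (Lc : ℝ) ^ (3 + 1)) ≠ 0 :=
    Finset.prod_ne_zero_iff.2 fun i _ => mul_ne_zero (stepScale_ne_zero _) (pow_ne_zero _ hLc)
  have hκ : κF k = ∏ i ∈ Finset.Ico k (n + 1), (stepScale 3 Lc (n + 1 - (i + 1)) * (Lc : ℝ) ^ (3 + 1)) := by
    rw [hκF k, card_box_four]
  rw [w_top n c κF wF hκF hwF, hwF k, hκ, div_div, ← sq, mul_comm]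
  exact div_mul_cancel₀ _ (pow_ne_zero 2 hP)

/-- [folklore] **`lock_relation` — R-FP-81, THE LOCK ALGEBRA**: `w₁ = −c·L8`, `(−2c)·r = cE` and the top word `w₁·r = cΛ` force `2·cΛ = L8·cE` (`c` and `r` both cancel). -/
theorem lock_relation (r w₁ cE cΛ L8 : ℝ) (hw₁ : w₁ = -(c * L8)) (hr : (-2 * c) * r = cE) (hword : w₁ * r = cΛ) : 2 * cΛ = L8 * cE := by
  subst hw₁
  rw [← hword, ← hr]
  ring

end Scalars

/-! ## §2 The Λ-contraction of the road's storey data at every level -/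

section Contraction

variable {κ : Type*} [Fintype κ] [DecidableEq κ] (yN : κ → Site (3 + 1)) (μN : κ → Fin (3 + 1))
  (hv : (κ → ℝ) → (↥(pbox (towerTorus Lc (fine Lc M) (n + 1))) × Fin (3 + 1) → ℝ))
  (cfF : ℕ → Fin (3 + 1) → Site (3 + 1) → Fin (3 + 1) → Site (3 + 1) → ℝ)
  (hcfF : ∀ (k : ℕ) (μ : Fin (3 + 1)) (s : Site (3 + 1)) (κ' : Fin (3 + 1)) (x : Site (3 + 1)), cfF k μ s κ' x
    = if k = n + 1 then
        ∑ ν : Fin (3 + 1), ∑' w : Site (3 + 1), lamCoeffOf (KInv (N := Lc ^ (n + 1 + 1)) (d := 3)) (Lc ^ (n + 1 + 1)) ν w κ' x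
          * compLinKer (fun _ => symLinKerAt (toSite R.r) Lc) Lc (n + 1) (μ, s) (ν, w)
      else (if x = (Lc : ℤ) • s ∧ κ' = μ then (1 : ℝ) else 0))
  (hbF : (k : ℕ) → (κ → ℝ) → (↥(pbox (towerTorus Lc (fine Lc M) k)) × Fin (3 + 1) → ℝ))
  (hhbF : ∀ (k : ℕ) (v : κ → ℝ) (ā : ↥(pbox (towerTorus Lc (fine Lc M) k)) × Fin (3 + 1)), hbF k v ā
    = if k = n + 1 then hv v (wrapPt (towerTorus Lc (fine Lc M) (n + 1)) (ā.1 : Site (3 + 1)), ā.2)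
      else ∑ y₀ : ↥(pbox (towerTorus Lc M k)), (if (ā.1 : Site (3 + 1)) = (Lc : ℤ) • (y₀ : Site (3 + 1)) then
        ∑ a : κ, v a * ∑' nn : Site (3 + 1), ∑ ν : Fin (3 + 1), ∑' w : Site (3 + 1),
          (∑ κ' : Fin (3 + 1), ∑' u' : Site (3 + 1),
              AN R (n + 1) u' (((Lc ^ (n + 1 + 1) : ℕ) : ℤ) • yN a) (Sum.inl κ') (Sum.inr (μN a))
                * lamCoeffOf (KInv (N := Lc ^ (n + 1 + 1)) (d := 3)) (Lc ^ (n + 1 + 1)) ν w κ' u')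
            * compLinKer (fun _ => symLinKerAt (toSite R.r) Lc) Lc k (ā.2, translate (towerTorus Lc M k) (y₀ : Site (3 + 1)) nn) (ν, w)
        else 0))

include hhbF hcfF in
/-- [folklore] **`lam_contraction` — AT EVERY LEVEL THE WRAPPER's SLOT WEIGHT `Σ_ā hb k v ā·ĉf_k(κ₁,s)(ā)` IS `Σ_{a′} v a′·λ̂′ᴿ_k^{(a′)}(κ₁, s)`** (periodised over the slot
torus `towerTorus Lc M k`): below the top by `TowerHLinkRowsLower.sum_hbDelta_mul_tsum_cfDelta`; at the top (`hb (n+1) = hv`, `cf (n+1) = cfTop`, `T′ = towerTorus Lc M (n+1)`)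
by linearity (`hhvl`), (J-W″) `hJW`, the (J-Λ-fold) `hfold` (an2 PART 25) and `TowerK1RowTopCoefficients.sum_exact_mul_tsum_cfTop_eq_zero`. -/
theorem lam_contraction (T' : Fin (3 + 1) → ℕ) (hT' : ∀ i, towerTorus Lc (fine Lc M) (n + 1) i = Lc * T' i)
    (hhvl : ∀ (r : ℝ) (x y : κ → ℝ), hv (r • x + y) = r • hv x + hv y)
    (lam : κ → ↥(pbox (towerTorus Lc (fine Lc M) (n + 1))) → ℝ)
    (hJW : ∀ (a : κ) (b : ↥(pbox (towerTorus Lc (fine Lc M) (n + 1))) × Fin (3 + 1)), hv (Pi.single a 1) b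
        = perF (towerTorus Lc (fine Lc M) (n + 1)) (AN R (n + 1)) (b.1, Sum.inl b.2)
            (wrapPt (towerTorus Lc (fine Lc M) (n + 1)) (((Lc ^ (n + 1 + 1) : ℕ) : ℤ) • yN a), Sum.inr (μN a))
          - ∑ s : ↥(pbox (towerTorus Lc (fine Lc M) (n + 1))), tgrad (towerTorus Lc (fine Lc M) (n + 1)) (b.1, Sum.inl b.2) s * lam a s)
    (hfold : ∀ (μ : Fin (3 + 1)) (y : Site (3 + 1)) (κ₁ : Fin (3 + 1)) (s₁ : Site (3 + 1)),
        ∑ ā : ↥(pbox (towerTorus Lc (fine Lc M) (n + 1))) × Fin (3 + 1),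
            perF (towerTorus Lc (fine Lc M) (n + 1)) (AN R (n + 1)) (ā.1, Sum.inl ā.2)
                (wrapPt (towerTorus Lc (fine Lc M) (n + 1)) (((Lc ^ (n + 1 + 1) : ℕ) : ℤ) • y), Sum.inr μ)
              * (∑' m : Site (3 + 1), ∑ ν : Fin (3 + 1), ∑' w : Site (3 + 1),
                  lamCoeffOf (KInv (N := Lc ^ (n + 1 + 1)) (d := 3)) (Lc ^ (n + 1 + 1)) ν w ā.2 (ā.1 : Site (3 + 1))
                    * compLinKer (fun _ => symLinKerAt (toSite R.r) Lc) Lc (n + 1) (κ₁, translate T' s₁ m) (ν, w))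
          = ∑' m : Site (3 + 1), ∑ ν : Fin (3 + 1), ∑' w : Site (3 + 1),
              (∑ κ' : Fin (3 + 1), ∑' u' : Site (3 + 1),
                  AN R (n + 1) u' (((Lc ^ (n + 1 + 1) : ℕ) : ℤ) • y) (Sum.inl κ') (Sum.inr μ)
                    * lamCoeffOf (KInv (N := Lc ^ (n + 1 + 1)) (d := 3)) (Lc ^ (n + 1 + 1)) ν w κ' u')
                * compLinKer (fun _ => symLinKerAt (toSite R.r) Lc) Lc (n + 1) (κ₁, translate T' s₁ m) (ν, w))
    (v : κ → ℝ) (k : ℕ) (hk : k ≤ n + 1) (κ₁ : Fin (3 + 1)) (s : Site (3 + 1)) :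
    (∑ ā : ↥(pbox (towerTorus Lc (fine Lc M) k)) × Fin (3 + 1), hbF k v ā *
        ∑' m : Site (3 + 1), cfF k κ₁ (translate (towerTorus Lc M k) s m) ā.2 (ā.1 : Site (3 + 1)))
      = ∑ a' : κ, v a' * (∑' nn : Site (3 + 1), ∑ ν : Fin (3 + 1), ∑' w : Site (3 + 1),
          (∑ κ' : Fin (3 + 1), ∑' u' : Site (3 + 1),
              AN R (n + 1) u' (((Lc ^ (n + 1 + 1) : ℕ) : ℤ) • yN a') (Sum.inl κ') (Sum.inr (μN a'))
                * lamCoeffOf (KInv (N := Lc ^ (n + 1 + 1)) (d := 3)) (Lc ^ (n + 1 + 1)) ν w κ' u')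
            * compLinKer (fun _ => symLinKerAt (toSite R.r) Lc) Lc k (κ₁, translate (towerTorus Lc M k) s nn) (ν, w)) := by
  have hL : 0 < Lc := Nat.pos_of_ne_zero (NeZero.ne Lc)
  rcases Nat.lt_or_ge k (n + 1) with hlt | hge
  · -- BELOW THE TOP: the δ-table and the root-bond embedding
    have hk1 : k ≠ n + 1 := Nat.ne_of_lt hlt
    simp only [hhbF, hcfF, if_neg hk1]
    exact sum_hbDelta_mul_tsum_cfDelta (towerTorus Lc M k) (towerTorus Lc (fine Lc M) k) (towerTorus_fine_apply_eq M k)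
      (fun i y => ∑ a' : κ, v a' * (∑' nn : Site (3 + 1), ∑ ν : Fin (3 + 1), ∑' w : Site (3 + 1),
          (∑ κ' : Fin (3 + 1), ∑' u' : Site (3 + 1),
              AN R (n + 1) u' (((Lc ^ (n + 1 + 1) : ℕ) : ℤ) • yN a') (Sum.inl κ') (Sum.inr (μN a'))
                * lamCoeffOf (KInv (N := Lc ^ (n + 1 + 1)) (d := 3)) (Lc ^ (n + 1 + 1)) ν w κ' u')
            * compLinKer (fun _ => symLinKerAt (toSite R.r) Lc) Lc k (i, translate (towerTorus Lc M k) y nn) (ν, w)))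
      (fun i y => lamLow_wrap R n M yN μN k v i y) κ₁ s
  · -- THE TOP: `k = n+1`
    have hkn : k = n + 1 := le_antisymm hk hge
    subst hkn
    have hT'eq : T' = towerTorus Lc M (n + 1) := by
      funext i
      have h := hT' i
      rw [towerTorus_fine_apply_eq M (n + 1) i] at h
      exact (Nat.eq_of_mul_eq_mul_left hL h).symm
    subst hT'eq
    simp only [hhbF, hcfF, if_true, wrapPt_of_mem, Prod.mk.eta]
    have hlin : ∀ (r : ℝ) (x y : κ → ℝ),
        (∑ ā : ↥(pbox (towerTorus Lc (fine Lc M) (n + 1))) × Fin (3 + 1), hv (r • x + y) ā *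
          ∑' m : Site (3 + 1), ∑ ν : Fin (3 + 1), ∑' w : Site (3 + 1),
            lamCoeffOf (KInv (N := Lc ^ (n + 1 + 1)) (d := 3)) (Lc ^ (n + 1 + 1)) ν w ā.2 (ā.1 : Site (3 + 1))
              * compLinKer (fun _ => symLinKerAt (toSite R.r) Lc) Lc (n + 1) (κ₁, translate (towerTorus Lc M (n + 1)) s m) (ν, w))
          = r * (∑ ā : ↥(pbox (towerTorus Lc (fine Lc M) (n + 1))) × Fin (3 + 1), hv x ā *
          ∑' m : Site (3 + 1), ∑ ν : Fin (3 + 1), ∑' w : Site (3 + 1),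
            lamCoeffOf (KInv (N := Lc ^ (n + 1 + 1)) (d := 3)) (Lc ^ (n + 1 + 1)) ν w ā.2 (ā.1 : Site (3 + 1))
              * compLinKer (fun _ => symLinKerAt (toSite R.r) Lc) Lc (n + 1) (κ₁, translate (towerTorus Lc M (n + 1)) s m) (ν, w))
          + ∑ ā : ↥(pbox (towerTorus Lc (fine Lc M) (n + 1))) × Fin (3 + 1), hv y ā *
          ∑' m : Site (3 + 1), ∑ ν : Fin (3 + 1), ∑' w : Site (3 + 1),
            lamCoeffOf (KInv (N := Lc ^ (n + 1 + 1)) (d := 3)) (Lc ^ (n + 1 + 1)) ν w ā.2 (ā.1 : Site (3 + 1))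
              * compLinKer (fun _ => symLinKerAt (toSite R.r) Lc) Lc (n + 1) (κ₁, translate (towerTorus Lc M (n + 1)) s m) (ν, w) := by
      intro r x y
      rw [hhvl]
      simp only [Pi.add_apply, Pi.smul_apply, smul_eq_mul, add_mul, Finset.sum_add_distrib, mul_assoc, ← Finset.mul_sum]
    rw [apply_eq_sum_mul_single_of_linear (fun x : κ → ℝ =>
        ∑ ā : ↥(pbox (towerTorus Lc (fine Lc M) (n + 1))) × Fin (3 + 1), hv x ā *
          ∑' m : Site (3 + 1), ∑ ν : Fin (3 + 1), ∑' w : Site (3 + 1),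
            lamCoeffOf (KInv (N := Lc ^ (n + 1 + 1)) (d := 3)) (Lc ^ (n + 1 + 1)) ν w ā.2 (ā.1 : Site (3 + 1))
              * compLinKer (fun _ => symLinKerAt (toSite R.r) Lc) Lc (n + 1) (κ₁, translate (towerTorus Lc M (n + 1)) s m) (ν, w)) hlin v]
    refine Finset.sum_congr rfl fun a' _ => ?_
    congr 1
    have hva : ∀ ā : ↥(pbox (towerTorus Lc (fine Lc M) (n + 1))) × Fin (3 + 1), hv (Pi.single a' 1) ā
        = perF (towerTorus Lc (fine Lc M) (n + 1)) (AN R (n + 1)) (ā.1, Sum.inl ā.2)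
            (wrapPt (towerTorus Lc (fine Lc M) (n + 1)) (((Lc ^ (n + 1 + 1) : ℕ) : ℤ) • yN a'), Sum.inr (μN a'))
          - ∑ s : ↥(pbox (towerTorus Lc (fine Lc M) (n + 1))), tgrad (towerTorus Lc (fine Lc M) (n + 1)) (ā.1, Sum.inl ā.2) s * lam a' s :=
      fun ā => hJW a' ā
    simp only [hva, sub_mul, Finset.sum_sub_distrib]
    rw [hfold (μN a') (yN a') κ₁ s, sum_exact_mul_tsum_cfTop_eq_zero R n M κ₁ s (lam a'), sub_zero]

end Contraction

/-! ## §3 The storey weight words -/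

section Words

variable {κ : Type*} [Fintype κ] [DecidableEq κ] (yN : κ → Site (3 + 1)) (μN : κ → Fin (3 + 1))
  (hv : (κ → ℝ) → (↥(pbox (towerTorus Lc (fine Lc M) (n + 1))) × Fin (3 + 1) → ℝ))
  (cfF : ℕ → Fin (3 + 1) → Site (3 + 1) → Fin (3 + 1) → Site (3 + 1) → ℝ)
  (hcfF : ∀ (k : ℕ) (μ : Fin (3 + 1)) (s : Site (3 + 1)) (κ' : Fin (3 + 1)) (x : Site (3 + 1)), cfF k μ s κ' x
    = if k = n + 1 then
        ∑ ν : Fin (3 + 1), ∑' w : Site (3 + 1), lamCoeffOf (KInv (N := Lc ^ (n + 1 + 1)) (d := 3)) (Lc ^ (n + 1 + 1)) ν w κ' x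
          * compLinKer (fun _ => symLinKerAt (toSite R.r) Lc) Lc (n + 1) (μ, s) (ν, w)
      else (if x = (Lc : ℤ) • s ∧ κ' = μ then (1 : ℝ) else 0))
  (hbF : (k : ℕ) → (κ → ℝ) → (↥(pbox (towerTorus Lc (fine Lc M) k)) × Fin (3 + 1) → ℝ))
  (hhbF : ∀ (k : ℕ) (v : κ → ℝ) (ā : ↥(pbox (towerTorus Lc (fine Lc M) k)) × Fin (3 + 1)), hbF k v ā
    = if k = n + 1 then hv v (wrapPt (towerTorus Lc (fine Lc M) (n + 1)) (ā.1 : Site (3 + 1)), ā.2)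
      else ∑ y₀ : ↥(pbox (towerTorus Lc M k)), (if (ā.1 : Site (3 + 1)) = (Lc : ℤ) • (y₀ : Site (3 + 1)) then
        ∑ a : κ, v a * ∑' nn : Site (3 + 1), ∑ ν : Fin (3 + 1), ∑' w : Site (3 + 1),
          (∑ κ' : Fin (3 + 1), ∑' u' : Site (3 + 1),
              AN R (n + 1) u' (((Lc ^ (n + 1 + 1) : ℕ) : ℤ) • yN a) (Sum.inl κ') (Sum.inr (μN a))
                * lamCoeffOf (KInv (N := Lc ^ (n + 1 + 1)) (d := 3)) (Lc ^ (n + 1 + 1)) ν w κ' u')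
            * compLinKer (fun _ => symLinKerAt (toSite R.r) Lc) Lc k (ā.2, translate (towerTorus Lc M k) (y₀ : Site (3 + 1)) nn) (ν, w)
        else 0))

include hhbF hcfF in
set_option maxHeartbeats 400000 in
/-- [folklore] **`weight_word` — an2 PART 19 §3's `hword` AT THE ROAD's DATA, EVERY STOREY, FROM THE ONE SCALAR ROW `w (n+1)·r = cΛ′`**: for `k ≤ n+1`, the pinned
direction `r•e_a`, every `κ₁` and every slot representative `ρ`,
`(Π_{i ∈ Ico k (n+1)} stepScale 3 Lc (n+1−(i+1))·Lc⁴)²·Σ'_m (w k·Σ_ā hb k (r•e_a) ā·cf k κ₁ (translate (towerTorus Lc M k) ρ m) ā.2 ā.1) = cΛ′·Σ'_m λ′ᴿ_k^{(a)}(κ₁, translate (towerTorus Lc M k) ρ m)`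
(`ι := pbox (towerTorus Lc (fine Lc M) k) × Fin 4`, `p₁ ā := ā.2`, `p₂ ā := ā.1`, `σ :=` the road's two-leg scalar, `Tc′ := towerTorus Lc M k`; the row's storey index `k_an2 = n+1−k`,
so its `compLinKer … (j − k_an2)` is this `compLinKer … k` after `Nat.sub_sub_self`).  Exchange `Σ'_m` with the finite `Σ_ā` (`hcf`), §2, §1. -/
theorem weight_word (c : ℝ) (κF wF : ℕ → ℝ)
    (hκF : ∀ k, κF k = ∏ i ∈ Finset.Ico k (n + 1), (stepScale 3 Lc (n + 1 - (i + 1)) * ((box (3 + 1) Lc).card : ℝ)))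
    (hwF : ∀ k, wF k = (-(c * ((Lc : ℝ) ^ (3 + 1)) ^ (n + 1 + 1))
        / ∏ i ∈ Finset.Ico k (n + 1), (stepScale 3 Lc (n + 1 - (i + 1)) * (Lc : ℝ) ^ (3 + 1))) / κF k)
    (T' : Fin (3 + 1) → ℕ) (hT' : ∀ i, towerTorus Lc (fine Lc M) (n + 1) i = Lc * T' i)
    (hhvl : ∀ (r : ℝ) (x y : κ → ℝ), hv (r • x + y) = r • hv x + hv y)
    (lam : κ → ↥(pbox (towerTorus Lc (fine Lc M) (n + 1))) → ℝ)
    (hJW : ∀ (a : κ) (b : ↥(pbox (towerTorus Lc (fine Lc M) (n + 1))) × Fin (3 + 1)), hv (Pi.single a 1) b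
        = perF (towerTorus Lc (fine Lc M) (n + 1)) (AN R (n + 1)) (b.1, Sum.inl b.2)
            (wrapPt (towerTorus Lc (fine Lc M) (n + 1)) (((Lc ^ (n + 1 + 1) : ℕ) : ℤ) • yN a), Sum.inr (μN a))
          - ∑ s : ↥(pbox (towerTorus Lc (fine Lc M) (n + 1))), tgrad (towerTorus Lc (fine Lc M) (n + 1)) (b.1, Sum.inl b.2) s * lam a s)
    (hfold : ∀ (μ : Fin (3 + 1)) (y : Site (3 + 1)) (κ₁ : Fin (3 + 1)) (s₁ : Site (3 + 1)),
        ∑ ā : ↥(pbox (towerTorus Lc (fine Lc M) (n + 1))) × Fin (3 + 1),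
            perF (towerTorus Lc (fine Lc M) (n + 1)) (AN R (n + 1)) (ā.1, Sum.inl ā.2)
                (wrapPt (towerTorus Lc (fine Lc M) (n + 1)) (((Lc ^ (n + 1 + 1) : ℕ) : ℤ) • y), Sum.inr μ)
              * (∑' m : Site (3 + 1), ∑ ν : Fin (3 + 1), ∑' w : Site (3 + 1),
                  lamCoeffOf (KInv (N := Lc ^ (n + 1 + 1)) (d := 3)) (Lc ^ (n + 1 + 1)) ν w ā.2 (ā.1 : Site (3 + 1))
                    * compLinKer (fun _ => symLinKerAt (toSite R.r) Lc) Lc (n + 1) (κ₁, translate T' s₁ m) (ν, w))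
          = ∑' m : Site (3 + 1), ∑ ν : Fin (3 + 1), ∑' w : Site (3 + 1),
              (∑ κ' : Fin (3 + 1), ∑' u' : Site (3 + 1),
                  AN R (n + 1) u' (((Lc ^ (n + 1 + 1) : ℕ) : ℤ) • y) (Sum.inl κ') (Sum.inr μ)
                    * lamCoeffOf (KInv (N := Lc ^ (n + 1 + 1)) (d := 3)) (Lc ^ (n + 1 + 1)) ν w κ' u')
                * compLinKer (fun _ => symLinKerAt (toSite R.r) Lc) Lc (n + 1) (κ₁, translate T' s₁ m) (ν, w))
    (cΛ' r : ℝ) (htop : wF (n + 1) * r = cΛ') (k : ℕ) (hk : k ≤ n + 1) (a : κ) (κ₁ : Fin (3 + 1)) (ρ : ↥(pbox (towerTorus Lc M k))) :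
    (∏ i ∈ Finset.Ico k (n + 1), (stepScale 3 Lc (n + 1 - (i + 1)) * (Lc : ℝ) ^ (3 + 1))) ^ 2 *
        ∑' m : Site (3 + 1), (wF k * ∑ ā : ↥(pbox (towerTorus Lc (fine Lc M) k)) × Fin (3 + 1),
          hbF k (r • (Pi.single a (1 : ℝ) : κ → ℝ)) ā * cfF k κ₁ (translate (towerTorus Lc M k) (ρ : Site (3 + 1)) m) ā.2 (ā.1 : Site (3 + 1)))
      = cΛ' * (∑' nn : Site (3 + 1), ∑ ν : Fin (3 + 1), ∑' w : Site (3 + 1),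
          (∑ κ' : Fin (3 + 1), ∑' u' : Site (3 + 1),
              AN R (n + 1) u' (((Lc ^ (n + 1 + 1) : ℕ) : ℤ) • yN a) (Sum.inl κ') (Sum.inr (μN a))
                * lamCoeffOf (KInv (N := Lc ^ (n + 1 + 1)) (d := 3)) (Lc ^ (n + 1 + 1)) ν w κ' u')
            * compLinKer (fun _ => symLinKerAt (toSite R.r) Lc) Lc k (κ₁, translate (towerTorus Lc M k) (ρ : Site (3 + 1)) nn) (ν, w)) := by
  -- exchange the period sum with the finite bond sum (`hcf`), pull `w k` out
  have hex : (∑' m : Site (3 + 1), (wF k * ∑ ā : ↥(pbox (towerTorus Lc (fine Lc M) k)) × Fin (3 + 1),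
          hbF k (r • (Pi.single a (1 : ℝ) : κ → ℝ)) ā * cfF k κ₁ (translate (towerTorus Lc M k) (ρ : Site (3 + 1)) m) ā.2 (ā.1 : Site (3 + 1))))
      = wF k * ∑ ā : ↥(pbox (towerTorus Lc (fine Lc M) k)) × Fin (3 + 1), hbF k (r • (Pi.single a (1 : ℝ) : κ → ℝ)) ā *
          ∑' m : Site (3 + 1), cfF k κ₁ (translate (towerTorus Lc M k) (ρ : Site (3 + 1)) m) ā.2 (ā.1 : Site (3 + 1)) := by
    rw [tsum_mul_left, Summable.tsum_finsetSum (fun ā _ =>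
      (cf_summable R n M cfF hcfF k ā.2 (ā.1 : Site (3 + 1)) κ₁ (ρ : Site (3 + 1))).mul_left _)]
    exact congrArg _ (Finset.sum_congr rfl fun ā _ => tsum_mul_left)
  rw [hex, lam_contraction R n M yN μN hv cfF hcfF hbF hhbF T' hT' hhvl lam hJW hfold (r • (Pi.single a (1 : ℝ) : κ → ℝ)) k hk κ₁ (ρ : Site (3 + 1)),
    Finset.sum_eq_single a (fun a' _ ha' => by rw [Pi.smul_apply, Pi.single_eq_of_ne ha', smul_zero, zero_mul])
      (fun h => absurd (Finset.mem_univ a) h),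
    Pi.smul_apply, Pi.single_eq_same, smul_eq_mul, mul_one, ← htop, ← legScalar_sq_mul_w n c κF wF hκF hwF k]
  ring

end Words

end Summit.QuantumFields.BalabanUV.Beta.FP.TowerWeightWords

end
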